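import Mathlib
import HarnessLib
import Summits.Ventures.LatticeQCDFlow.Exactness.SUNJitteredLeapfrogHMC
import Summits.Ventures.LatticeQCDFlow.Exactness.ExactStepBoxMinorised
import Summits.Ventures.LatticeQCDFlow.Exactness.KickLawsNearIdentity
import Summits.Ventures.LatticeQCDFlow.Exactness.HaarBoxMinorants
import Summits.Ventures.LatticeQCDFlow.Exactness.CabibboMarinariORSweep

/-!
# The engine's jittered `SU(N)` HMC followed by over-relaxation sweeps (or ANY exact step) converges whenever an atom of the jitter law is a short trajectory

HONEST FRAMING: exact (Metropolis-corrected) sampling algorithms for lattice gauge theory;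
figures of merit are autocorrelation/cost numbers at stated couplings and volumes; no
continuum-physics claim.

Venture `LatticeQCDFlow` (cell pub-lqcd), topic `Exactness`, FANOUT row 9 (eng-latcore, the engine's
`latflow.core.updates.composite_sweep(f, β, 'hmc', n_or)` with `hmc.HMC.trajectory(…, tau_jitter = j)`: one
jittered leapfrog HMC update, then `n_or` Cabibbo–Marinari over-relaxation sweeps).  NEW WORK of the cell over
the tree (`SUNJitteredLeapfrogHMC.lean`: `sunJitterHMCN`, `wilson_sunWilsonForceJitterHMC_invariant`;
`JitteredHMC.lean`: `smul_frozen_le_jitterHMC`, `isMarkovKernel_jitterHMC`; `SUNMultiStepLeapfrogHMCErgodic.lean`: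
`sunLeapfrogHMCN_minorised_walk`; `KickLawsNearIdentity.lean`: `exists_smul_haar_restrict_le_chartKickR`;
`HaarBoxMinorants.lean`: `smul_restrict_box_le_mulWalk_pi`; `ExactStepBoxMinorised.lean`:
`exactStep_uniformlyErgodic_of_box_minorised`; `CabibboMarinariORSweep.lean`: `cmORSweep`, `cmORSweep_invariant`);
nothing is cited as a fact; no number is claimed.

THE POINT.  A FIXED-length HMC update followed by OR sweeps is typed only for short trajectories
(`SUNLeapfrogHMCORSweepErgodic.lean`); with `tau_jitter` the restriction moves from the trajectory length
to the JITTER LAW: it suffices that ONE atom of the law is a short trajectory — the production length `τ`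
itself may be anything.

* §1 **`engine_sunLeapfrogHMCN_box_minorised`** / `…_of_trajLength` — the engine's fixed-step `n`-step
  leapfrog HMC update (short trajectory) dominates `κ · Haar^{⊗links}|_{box(U)}` from EVERY configuration
  `U`, ONE open `V ∋ 1` and ONE `κ ≠ 0` (gen-18's walk minorant + the chart kick dominating Haar near `1` +
  the box lemma; this is the minorant `SUNLeapfrogHMCORSweepErgodic.lean` uses inside its proof, stated).
* §2 **`wilson_sunWilsonForceJitterHMC_exactStep_uniformlyErgodic`** — torus `(ℤ/L)^d`, `SU(N)`, the
  engine's momenta / kinetic term / Wilson force law / Metropolis test on `(β/N)·S_W + T`, labels `l ∼ η` on a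
  countable set, trajectory lengths `τ_l`, step numbers `nstep_l`, steps `τ_l/nstep_l`: there is `τ₀ > 0`
  (`N, d, L, β` only) such that for every `nstep`, `τ`, `η` and atom `l₀` (`η{l₀} ≠ 0`, `nstep l₀ ≥ 1`,
  `0 < τ l₀ ≤ τ₀`) and EVERY Markov kernel `P`
  leaving the Wilson measure invariant, `P ∘ₖ K_jit` converges to `wilsonMeasure (β/N)` geometrically in total
  variation from EVERY initial law at every time and the Wilson measure is its unique invariant probability
  law; **`wilson_sunWilsonForceJitterHMC_orSweep_uniformlyErgodic`** — in particular for `P` = ANY schedule of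
  Cabibbo–Marinari over-relaxation hits (`L ≥ 2`): THE ENGINE'S `'hmc' (jittered) + n_or × 'or'` AS RUN.

* (§3, detailed balance of the jittered kernels — `sunJitterHMCN_isReversible`,
  `wilson_sunWilsonForceJitterHMC_isReversible` — is the separate file `SUNJitteredHMCReversible.lean`, which needs
  `JitteredHMCReversible.lean`.)

NOT CLAIMED: any value of `τ₀`, of the power or the rate; anything for an atomless jitter law or a jitter
law all of whose atoms are long trajectories; OMF words; floating point.
-/

noncomputable section

namespace Summit.Ventures.LatticeQCDFlow.Exactness

open MeasureTheory ProbabilityTheory ProbabilityTheory.Kernel Set Metric Function Filter Topology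
open Literature.MathematicalPhysics.QuantumFieldTheory
open Literature.MathematicalPhysics.QuantumLattice (fundamentalRep continuous_fundamentalRep connectedSpace_specialUnitaryGroup)
open scoped ENNReal Matrix Matrix.Norms.Operator NNReal

set_option backward.isDefEq.respectTransparency false

/-! ## §1 The engine's fixed-step HMC update dominates product Haar on a box -/

section Box

variable (N : ℕ) [NeZero N] {L : Type*} [Fintype L] {ε : ℝ} {nstep : ℕ}
  {g : (L → Matrix.specialUnitaryGroup (Fin N) ℂ) → L → SUNCoords N}
  {S : (L → Matrix.specialUnitaryGroup (Fin N) ℂ) → ℝ} {b Kg s : ℝ}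

/-- **THE ENGINE'S `n`-STEP LEAPFROG HMC UPDATE DOMINATES PRODUCT HAAR ON A BOX AROUND EVERY CONFIGURATION**
(short trajectories; hypotheses of `engine_sunLeapfrogHMCN_uniformlyErgodic`): there are an open `V ∋ 1` and
`κ ≠ 0` with `κ · Haar^{⊗links}|_{ {W : ∀ j, W_j U_j⁻¹ ∈ V} } ≤ K(U, ·)` for EVERY `U`. -/
theorem engine_sunLeapfrogHMCN_box_minorised (hε : 0 < ε) (hn : 1 ≤ nstep) (hg : Measurable g)
    (hb0 : 0 ≤ b) (hb : ∀ u l, ‖g u l‖ ≤ b) (hK0 : 0 ≤ Kg)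
    (hK : ∀ U U', ‖g U - g U'‖ ≤ Kg * ‖coeConfig U - coeConfig U'‖) (hS : Measurable S) (hs : ∀ u, |S u| ≤ s)
    (h1 : nstep * ε ≤ sunShortTrajThreshold (sunCoordι N) (sunCoordι_injective N))
    (h2 : (2 * nstep + 1) * b ≤ sunShortTrajThreshold (sunCoordι N) (sunCoordι_injective N))
    (h3 : Kg * ε * (nstep : ℝ) ^ 2 ≤ sunShortTrajThreshold (sunCoordι N) (sunCoordι_injective N)) :
    ∃ V : Set (Matrix.specialUnitaryGroup (Fin N) ℂ), IsOpen V ∧ (1 : Matrix.specialUnitaryGroup (Fin N) ℂ) ∈ V ∧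
      ∃ κ : ℝ≥0∞, κ ≠ 0 ∧ ∀ U : L → Matrix.specialUnitaryGroup (Fin N) ℂ,
        κ • (Measure.pi fun _ : L => haarProbability (Matrix.specialUnitaryGroup (Fin N) ℂ)).restrict
            {W | ∀ j, W j * (U j)⁻¹ ∈ V} ≤
          sunLeapfrogHMCN (sunCoordι N) (sunCoordι_skew N) ε (Measure.addHaar : Measure (SUNCoords N))
            (sunKinetic N) hg S nstep U := by
  -- the walk minorant of gen-18, in the engine's coordinates
  obtain ⟨δ, hδ, hwalk⟩ := sunLeapfrogHMCN_minorised_walk (sunCoordι N) (sunCoordι_skew N) (sunCoordι_injective N)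
    Measure.addHaar (τ := fun R => Fintype.card L * ((N + 4 * Fintype.card (UpperPair N)) * R ^ 2))
    (sunCoordι_range N) hε hn (measurable_sunKinetic N) (sunKinetic_nonneg N) (sunKinetic_le_of_norm_le N)
    (sunMomentumWeight_sunKinetic_ne_top N Measure.addHaar) hg hb0 hb hK0 hK hS hs h1 h2 h3
  -- the chart kick dominates Haar near `1`
  obtain ⟨V, hV, a, ha, hle⟩ := exists_smul_haar_restrict_le_chartKickR (sunCoordι N) (sunCoordι_skew N)
    Measure.addHaar (sunCoordι_injective N) (sunCoordι_range N) (show 0 < nstep * ε / 3 by positivity)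
  have hcoord : ∀ _j : L, a • (haarProbability (Matrix.specialUnitaryGroup (Fin N) ℂ)).restrict (interior V) ≤
      chartKickR (sunCoordι N) (sunCoordι_skew N) (Measure.addHaar : Measure (SUNCoords N)) (nstep * ε / 3) := fun _ =>
    calc a • (haarProbability (Matrix.specialUnitaryGroup (Fin N) ℂ)).restrict (interior V)
        ≤ a • (haarProbability (Matrix.specialUnitaryGroup (Fin N) ℂ)).restrict V := by
          refine Measure.le_iff'.2 fun A => ?_
          simp only [Measure.smul_apply, smul_eq_mul]
          exact mul_le_mul' le_rfl (Measure.le_iff'.1 (Measure.restrict_mono interior_subset le_rfl) A)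
      _ ≤ _ := hle
  haveI : IsProbabilityMeasure (chartKickR (sunCoordι N) (sunCoordι_skew N) (Measure.addHaar : Measure (SUNCoords N))
      (nstep * ε / 3)) :=
    isProbabilityMeasure_chartKickR (sunCoordι N) (sunCoordι_skew N) Measure.addHaar (show 0 < nstep * ε / 3 by positivity)
  refine ⟨interior V, isOpen_interior, mem_interior_iff_mem_nhds.2 hV, δ * ∏ _j : L, a,
    mul_ne_zero hδ.ne' (Finset.prod_ne_zero_iff.2 fun _ _ => ha), fun U => ?_⟩
  calc (δ * ∏ _j : L, a) • (Measure.pi fun _ : L => haarProbability (Matrix.specialUnitaryGroup (Fin N) ℂ)).restrict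
          {W | ∀ j, W j * (U j)⁻¹ ∈ interior V}
      = δ • ((∏ _j : L, a) • (Measure.pi fun _ : L => haarProbability (Matrix.specialUnitaryGroup (Fin N) ℂ)).restrict
          {W | ∀ j, W j * (U j)⁻¹ ∈ interior V}) := by rw [smul_smul]
    _ ≤ δ • mulWalk (Measure.pi fun _ : L => chartKickR (sunCoordι N) (sunCoordι_skew N)
          (Measure.addHaar : Measure (SUNCoords N)) (nstep * ε / 3)) U := by
        refine Measure.le_iff'.2 fun A => ?_
        simp only [Measure.smul_apply, smul_eq_mul]
        exact mul_le_mul' le_rfl (Measure.le_iff'.1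
          (smul_restrict_box_le_mulWalk_pi (μH := haarProbability (Matrix.specialUnitaryGroup (Fin N) ℂ)) hcoord U) A)
    _ ≤ _ := hwalk U

variable {F : (L → Matrix.specialUnitaryGroup (Fin N) ℂ) → L → SUNCoords N} {Fmax KF : ℝ}

/-- **THE SAME IN TRAJECTORY-LENGTH FORM**: for a measurable force field bounded by `F_max` per link and
`K_F`-Lipschitz and a measurable action bounded by `s` there is `τ₀ > 0` such that for EVERY `n ≥ 1`, `ε > 0`
with `nε ≤ τ₀` the engine's `n`-step update with half kick `−(ε/2)·F` is box-minorised. -/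
theorem engine_sunLeapfrogHMCN_box_minorised_of_trajLength (hF : Measurable F) (hF0 : 0 ≤ Fmax)
    (hFb : ∀ U l, ‖F U l‖ ≤ Fmax) (hKF0 : 0 ≤ KF) (hFK : ∀ U U', ‖F U - F U'‖ ≤ KF * ‖coeConfig U - coeConfig U'‖)
    (hS : Measurable S) (hs : ∀ u, |S u| ≤ s) :
    ∃ τ₀ : ℝ, 0 < τ₀ ∧ ∀ (nstep : ℕ) (ε : ℝ), 1 ≤ nstep → 0 < ε → nstep * ε ≤ τ₀ →
      ∃ V : Set (Matrix.specialUnitaryGroup (Fin N) ℂ), IsOpen V ∧ (1 : Matrix.specialUnitaryGroup (Fin N) ℂ) ∈ V ∧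
        ∃ κ : ℝ≥0∞, κ ≠ 0 ∧ ∀ U : L → Matrix.specialUnitaryGroup (Fin N) ℂ,
          κ • (Measure.pi fun _ : L => haarProbability (Matrix.specialUnitaryGroup (Fin N) ℂ)).restrict
              {W | ∀ j, W j * (U j)⁻¹ ∈ V} ≤
            sunLeapfrogHMCN (sunCoordι N) (sunCoordι_skew N) ε (Measure.addHaar : Measure (SUNCoords N))
              (sunKinetic N) (measurable_halfKick_sun N hF ε) S nstep U := by
  set s₀ := sunShortTrajThreshold (sunCoordι N) (sunCoordι_injective N) with hs₀
  have hs₀0 : 0 < s₀ := sunShortTrajThreshold_pos _ _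
  refine ⟨min s₀ (min (s₀ / (3 * Fmax + 1)) (Real.sqrt (s₀ / (KF + 1)))),
    lt_min hs₀0 (lt_min (by positivity) (Real.sqrt_pos.2 (by positivity))), fun nstep ε hn hε hτ => ?_⟩
  obtain ⟨h1, h2, h3⟩ := trajLength_threshold_arith hs₀0 hF0 hKF0 hn hε rfl hτ
  refine engine_sunLeapfrogHMCN_box_minorised N hε hn (measurable_halfKick_sun N hF ε) (b := ε / 2 * Fmax)
    (Kg := ε / 2 * KF) (by positivity) (fun U l => ?_) (by positivity) (fun U U' => ?_) hS hs h1 h2 h3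
  · rw [Pi.smul_apply, norm_smul, Real.norm_eq_abs, abs_neg, abs_of_pos (by positivity)]
    exact mul_le_mul_of_nonneg_left (hFb U l) (by positivity)
  · have hsub : (-(ε / 2)) • F U - (-(ε / 2)) • F U' = (-(ε / 2)) • (F U - F U') := by
      funext l; simp only [Pi.sub_apply, Pi.smul_apply, smul_sub]
    rw [hsub, norm_smul, Real.norm_eq_abs, abs_neg, abs_of_pos (by positivity), mul_assoc]
    exact mul_le_mul_of_nonneg_left (hFK U U') (by positivity)

end Box

/-! ## §2 The jittered engine HMC followed by ANY exact step; the `'hmc' (jittered) + n_or × 'or'` composite -/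

section Wilson

variable (N : ℕ) [NeZero N] {d L : ℕ} [NeZero L]
variable {Lab : Type*} [Countable Lab] [MeasurableSpace Lab] [MeasurableSingletonClass Lab]

/-- **THE ENGINE'S JITTERED `SU(N)` HMC FOLLOWED BY ANY EXACT STEP CONVERGES TO THE WILSON MEASURE FROM EVERY
START WHENEVER AN ATOM OF THE JITTER LAW IS A SHORT TRAJECTORY.**  Torus `(ℤ/L)^d`, `SU(N)`, any real `β`, the
engine's momenta / kinetic term / Wilson force law `sunWilsonForceLaw N β`, Metropolis test on `(β/N)·S_W + T`;
labels `l ∼ η` (countable label set), trajectory lengths `τ_l`, `nstep_l` steps of size `τ_l/nstep_l`.  There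
is `τ₀ > 0` (on `N, d, L, β` only; not computed) such that for EVERY `nstep`, EVERY `τ`, EVERY jitter law `η`,
EVERY label `l₀` with `η{l₀} ≠ 0`, `nstep l₀ ≥ 1`, `0 < τ l₀ ≤ τ₀`, and EVERY Markov kernel `P` leaving `wilsonMeasure (β/N)`
invariant: `|μ₀ (P ∘ₖ K_jit)ᵗ(A) − wilsonMeasure (β/N) (A)| ≤ (1 − δ)^{⌊t/(mm+1)⌋}` for some `mm`, `δ ∈ (0, 1]`,
EVERY initial law `μ₀`, every `t`, every `A`; and the Wilson measure is the unique invariant probability law of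
`P ∘ₖ K_jit`. -/
theorem wilson_sunWilsonForceJitterHMC_exactStep_uniformlyErgodic (β : ℝ) :
    ∃ τ₀ : ℝ, 0 < τ₀ ∧ ∀ (nstep : Lab → ℕ) (τ : Lab → ℝ) (η : Measure Lab) [IsProbabilityMeasure η] (l₀ : Lab),
      1 ≤ nstep l₀ → η {l₀} ≠ 0 → 0 < τ l₀ → τ l₀ ≤ τ₀ →
      ∀ (P : Kernel (GaugeConfig d L (Matrix.specialUnitaryGroup (Fin N) ℂ))
          (GaugeConfig d L (Matrix.specialUnitaryGroup (Fin N) ℂ))) [IsMarkovKernel P],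
        Invariant P (wilsonMeasure (d := d) (L := L) (fundamentalRep (Fin N)) (β / N)) →
      ∃ mm : ℕ, ∃ δ : ℝ, 0 < δ ∧ δ ≤ 1 ∧
        (∀ (μ₀ : Measure (GaugeConfig d L (Matrix.specialUnitaryGroup (Fin N) ℂ))) [IsProbabilityMeasure μ₀]
          (t : ℕ) (A : Set (GaugeConfig d L (Matrix.specialUnitaryGroup (Fin N) ℂ))),
          |((fun m : Measure (GaugeConfig d L (Matrix.specialUnitaryGroup (Fin N) ℂ)) =>
                m.bind (P ∘ₖ sunJitterHMCN (sunCoordι N) (sunCoordι_skew N) (Measure.addHaar : Measure (SUNCoords N))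
                  (sunKinetic N) (fun l => τ l / nstep l)
                  (fun l => measurable_halfKick_sun N (measurable_sunWilsonForceLaw_coeConfig N (d := d) (L := L) β)
                    (τ l / nstep l))
                  (fun U => β / N * wilsonAction (fundamentalRep (Fin N)) U) nstep η))^[t] μ₀).real A
              - (wilsonMeasure (d := d) (L := L) (fundamentalRep (Fin N)) (β / N)).real A| ≤ (1 - δ) ^ (t / (mm + 1))) ∧
        ∀ (π' : Measure (GaugeConfig d L (Matrix.specialUnitaryGroup (Fin N) ℂ))) [IsProbabilityMeasure π'],
          Invariant (P ∘ₖ sunJitterHMCN (sunCoordι N) (sunCoordι_skew N) (Measure.addHaar : Measure (SUNCoords N))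
            (sunKinetic N) (fun l => τ l / nstep l)
            (fun l => measurable_halfKick_sun N (measurable_sunWilsonForceLaw_coeConfig N (d := d) (L := L) β)
              (τ l / nstep l))
            (fun U => β / N * wilsonAction (fundamentalRep (Fin N)) U) nstep η) π' →
          π' = wilsonMeasure (d := d) (L := L) (fundamentalRep (Fin N)) (β / N) := by
  haveI : ConnectedSpace (Matrix.specialUnitaryGroup (Fin N) ℂ) := connectedSpace_specialUnitaryGroup
  obtain ⟨s, hs⟩ := exists_bound_smul_wilsonAction_sun N (d := d) (L := L) (fundamentalRep (Fin N))
    (continuous_fundamentalRep (Fin N)) (β / N)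
  obtain ⟨Fmax, KF, hF0, hKF0, hFb, hFK⟩ := sunWilsonForceLaw_bounds N (d := d) (L := L) β
  obtain ⟨τ₀, hτ₀, hbox⟩ := engine_sunLeapfrogHMCN_box_minorised_of_trajLength N
    (measurable_sunWilsonForceLaw_coeConfig N (d := d) (L := L) β) hF0 hFb hKF0 hFK
    (measurable_engineWilsonAction N β) hs
  refine ⟨τ₀, hτ₀, fun nstep τ η _ l₀ hn hl₀ hτl hτl₀ P _ hP => ?_⟩
  have hn0 : (0 : ℝ) < nstep l₀ := by exact_mod_cast hn
  have hε : 0 < τ l₀ / nstep l₀ := div_pos hτl hn0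
  have hnε : (nstep l₀ : ℝ) * (τ l₀ / nstep l₀) ≤ τ₀ := by rwa [mul_div_cancel₀ _ hn0.ne']
  obtain ⟨V, hVo, hV1, κ, hκ, hK⟩ := hbox (nstep l₀) (τ l₀ / nstep l₀) hn hε hnε
  haveI := isProbabilityMeasure_sunMomentumLaw (L := Edge d L) (Measure.addHaar : Measure (SUNCoords N))
    (sunKinetic N) (measurable_sunKinetic N) (sunMomentumWeight_sunKinetic_ne_top N Measure.addHaar)
  -- the jittered update dominates the atom's update, hence product Haar on the box
  have hboxJ : ∀ U : GaugeConfig d L (Matrix.specialUnitaryGroup (Fin N) ℂ),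
      (η {l₀} * κ) • (Measure.pi fun _ : Edge d L => haarProbability (Matrix.specialUnitaryGroup (Fin N) ℂ)).restrict
          {W | ∀ j, W j * (U j)⁻¹ ∈ V} ≤
        sunJitterHMCN (sunCoordι N) (sunCoordι_skew N) (Measure.addHaar : Measure (SUNCoords N)) (sunKinetic N)
          (fun l => τ l / nstep l)
          (fun l => measurable_halfKick_sun N (measurable_sunWilsonForceLaw_coeConfig N (d := d) (L := L) β) (τ l / nstep l))
          (fun U => β / N * wilsonAction (fundamentalRep (Fin N)) U) nstep η U := fun U =>
    calc (η {l₀} * κ) • (Measure.pi fun _ : Edge d L => haarProbability (Matrix.specialUnitaryGroup (Fin N) ℂ)).restrict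
            {W | ∀ j, W j * (U j)⁻¹ ∈ V}
        = η {l₀} • (κ • (Measure.pi fun _ : Edge d L => haarProbability (Matrix.specialUnitaryGroup (Fin N) ℂ)).restrict
            {W | ∀ j, W j * (U j)⁻¹ ∈ V}) := by rw [smul_smul]
      _ ≤ η {l₀} • sunLeapfrogHMCN (sunCoordι N) (sunCoordι_skew N) (τ l₀ / nstep l₀) (Measure.addHaar : Measure (SUNCoords N))
            (sunKinetic N) (measurable_halfKick_sun N (measurable_sunWilsonForceLaw_coeConfig N (d := d) (L := L) β)
              (τ l₀ / nstep l₀)) (fun U => β / N * wilsonAction (fundamentalRep (Fin N)) U) (nstep l₀) U := by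
          refine Measure.le_iff'.2 fun A => ?_
          simp only [Measure.smul_apply, smul_eq_mul]
          exact mul_le_mul' le_rfl (Measure.le_iff'.1 (hK U) A)
      _ ≤ _ := by
          simpa only [sunJitterHMCN, sunLeapfrogHMCN] using
            smul_frozen_le_jitterHMC (η := η) (μP := sunMomentumLaw (Measure.addHaar : Measure (SUNCoords N)) (sunKinetic N))
              (hΦ := measurable_jitterMap_of_countable fun l => measurable_sunLeapfrogProposalN (sunCoordι N)
                (sunCoordι_skew N) (τ l / nstep l) (nstep l)
                (measurable_halfKick_sun N (measurable_sunWilsonForceLaw_coeConfig N (d := d) (L := L) β) (τ l / nstep l)))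
              (S := fun U => β / N * wilsonAction (fundamentalRep (Fin N)) U)
              (measurable_engineWilsonAction N β) (measurable_sunKinetic N) l₀ U
  -- exactness and the Markov property of the jittered update
  haveI : IsMarkovKernel (sunJitterHMCN (sunCoordι N) (sunCoordι_skew N) (Measure.addHaar : Measure (SUNCoords N))
      (sunKinetic N) (fun l => τ l / nstep l)
      (fun l => measurable_halfKick_sun N (measurable_sunWilsonForceLaw_coeConfig N (d := d) (L := L) β) (τ l / nstep l))
      (fun U => β / N * wilsonAction (fundamentalRep (Fin N)) U) nstep η) := by
    unfold sunJitterHMCN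
    exact isMarkovKernel_jitterHMC _ _ η _ (measurable_engineWilsonAction N β) (measurable_sunKinetic N)
  have hKinv := sunJitterHMCN_invariant_gibbs (sunCoordι N) (sunCoordι_skew N) (Measure.addHaar : Measure (SUNCoords N))
    (ε := fun l => τ l / nstep l) (N := nstep) (η := η)
    (fun l => measurable_halfKick_sun N (measurable_sunWilsonForceLaw_coeConfig N (d := d) (L := L) β) (τ l / nstep l))
    (measurable_sunKinetic N) (sunMomentumWeight_sunKinetic_ne_top N Measure.addHaar) (measurable_engineWilsonAction N β)
  obtain ⟨hlo, hhi⟩ := gibbsWeight_pinched (L := Edge d L) (n := Fin N) hs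
  rw [← gibbsProbability_smul_wilsonAction_eq N (d := d) (L := L) (fundamentalRep (Fin N)) (β / N)] at hP ⊢
  exact exactStep_uniformlyErgodic_of_box_minorised (Real.exp_pos (-s)) hlo hhi hKinv hVo hV1
    (mul_ne_zero hl₀ hκ) hboxJ P hP

variable {m : Type*} [Fintype m] [DecidableEq m]

/-- **THE ENGINE'S `'hmc' (WITH tau_jitter) + n_or × 'or'` COMPOSITE AS RUN CONVERGES TO THE WILSON MEASURE
FROM EVERY START WHENEVER AN ATOM OF THE JITTER LAW IS A SHORT TRAJECTORY** (`L ≥ 2`; `P` = ANY schedule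
`sched` of Cabibbo–Marinari over-relaxation hits): same `τ₀`; for every `nstep`, `τ`, `η`, atom `l₀` with
`nstep l₀ ≥ 1`, `0 < τ l₀ ≤ τ₀` and every `sched`, geometric convergence in total variation from EVERY initial law at every
time, and the Wilson measure is the unique invariant probability law. -/
theorem wilson_sunWilsonForceJitterHMC_orSweep_uniformlyErgodic (hL : 2 ≤ L) (β : ℝ) :
    ∃ τ₀ : ℝ, 0 < τ₀ ∧ ∀ (nstep : Lab → ℕ) (τ : Lab → ℝ) (η : Measure Lab) [IsProbabilityMeasure η] (l₀ : Lab)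
      (sched : List (Edge d L × (Fin N ≃ Fin 2 ⊕ m))),
      1 ≤ nstep l₀ → η {l₀} ≠ 0 → 0 < τ l₀ → τ l₀ ≤ τ₀ →
      ∃ mm : ℕ, ∃ δ : ℝ, 0 < δ ∧ δ ≤ 1 ∧
        (∀ (μ₀ : Measure (GaugeConfig d L (Matrix.specialUnitaryGroup (Fin N) ℂ))) [IsProbabilityMeasure μ₀]
          (t : ℕ) (A : Set (GaugeConfig d L (Matrix.specialUnitaryGroup (Fin N) ℂ))),
          |((fun μ' : Measure (GaugeConfig d L (Matrix.specialUnitaryGroup (Fin N) ℂ)) =>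
                μ'.bind (cmORSweep sched ∘ₖ sunJitterHMCN (sunCoordι N) (sunCoordι_skew N)
                  (Measure.addHaar : Measure (SUNCoords N)) (sunKinetic N) (fun l => τ l / nstep l)
                  (fun l => measurable_halfKick_sun N (measurable_sunWilsonForceLaw_coeConfig N (d := d) (L := L) β)
                    (τ l / nstep l))
                  (fun U => β / N * wilsonAction (fundamentalRep (Fin N)) U) nstep η))^[t] μ₀).real A
              - (wilsonMeasure (d := d) (L := L) (fundamentalRep (Fin N)) (β / N)).real A| ≤ (1 - δ) ^ (t / (mm + 1))) ∧
        ∀ (π' : Measure (GaugeConfig d L (Matrix.specialUnitaryGroup (Fin N) ℂ))) [IsProbabilityMeasure π'],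
          Invariant (cmORSweep sched ∘ₖ sunJitterHMCN (sunCoordι N) (sunCoordι_skew N)
            (Measure.addHaar : Measure (SUNCoords N)) (sunKinetic N) (fun l => τ l / nstep l)
            (fun l => measurable_halfKick_sun N (measurable_sunWilsonForceLaw_coeConfig N (d := d) (L := L) β)
              (τ l / nstep l))
            (fun U => β / N * wilsonAction (fundamentalRep (Fin N)) U) nstep η) π' →
          π' = wilsonMeasure (d := d) (L := L) (fundamentalRep (Fin N)) (β / N) := by
  obtain ⟨τ₀, hτ₀, h⟩ := wilson_sunWilsonForceJitterHMC_exactStep_uniformlyErgodic N (d := d) (L := L) (Lab := Lab) β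
  refine ⟨τ₀, hτ₀, fun nstep τ η _ l₀ sched hn hl₀ hτl hτl₀ => h nstep τ η l₀ hn hl₀ hτl hτl₀ (cmORSweep sched) ?_⟩
  -- the OR schedule leaves the Wilson measure invariant
  rw [← gibbsProbability_smul_wilsonAction_eq N (d := d) (L := L) (fundamentalRep (Fin N)) (β / N)]
  refine invariant_gibbsProbability ?_
  have hdens : (fun U : GaugeConfig d L (Matrix.specialUnitaryGroup (Fin N) ℂ) =>
      ENNReal.ofReal (Real.exp (-(β / N * wilsonAction (fundamentalRep (Fin N)) U)))) =
      gibbsDensity fun U : GaugeConfig d L (Matrix.specialUnitaryGroup (Fin N) ℂ) => β / N * wilsonAction (suRep N) U := by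
    funext U; rfl
  rw [hdens]
  exact cmORSweep_invariant (β / N) hL sched

end Wilson

end Summit.Ventures.LatticeQCDFlow.Exactness
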